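import Summits.AtomisticToContinuum.HydrodynamicLimit.Theses.InformationPercolationEngine
import Literature.MathematicalPhysics.KineticTheory.TaggedSphereCarleman
import Literature.Probability.Distributions.GaussianSphereMarginal
import Summits.AtomisticToContinuum.HydrodynamicLimit.Theorems.SpectralContractionR.Negative.WithoutMeanZero
import Summits.AtomisticToContinuum.HydrodynamicLimit.Theorems.SpectralContractionR.Negative.WithoutMeasurable
import Summits.AtomisticToContinuum.HydrodynamicLimit.Theorems.SpectralContractionR.Negative.WithoutIntegrableSpikes

/-!
# The spike witness `f = g - m` and its honest `K f` (towards `SpectralContractionR` without integrability, 2/3)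

Second of three files refuting `SpectralContractionRWithoutIntegrable` (see `Negative/WithoutIntegrable.lean`).
Here: `g νM ∈ L¹` (`integrable_g_nuM`: `νM` is bounded on the unit ball and `Σ a_n r_n³ < ∞`), the π-mean
`m = ∫ g νM / ∫ νM > 0` (`mShift`, `mShift_pos`), the witness `f = g - m` is measurable and HONESTLY π-centred
(`integral_f_nuM`); and the TYPED one-collision average of the crux applied to `f` is honest for EVERY `v`:
`K f v = ν(v)⁻¹ ∫ k₁(v,u) g(v+u) du - m` (`K_f_eq`, from the tree's pointwise Carleman representation
`linearBoltzmannGain_eq_carlemanGain` under the absolute convergence supplied by file 1), with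
`0 ≤ ∫ k₁ g(v+·) ≤ C₀` measurably in `v` (`Cg_nonneg`, `Cg_le`, `measurable_Cg`) and therefore `K f` bounded and
`≤ -m/2` outside a large ball because `ν(v) ≥ c|v|` (`Kf_estimates`).
-/

noncomputable section

open MeasureTheory Metric Real Set Filter Topology ProbabilityTheory
open scoped InnerProductSpace ENNReal

namespace Summit.AtomisticToContinuum.HydrodynamicLimit.Theorems

namespace SpectralContractionRWithoutIntegrable

open Literature.MathematicalPhysics.KineticTheory
open Literature.Analysis.FunctionSpaces (maxwellianBeta maxwellianBeta_one maxwellianBeta_pos)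
open Literature.Analysis.FluidPDE (globalMaxwellian globalMaxwellian_pos)

/-! ### `g ∈ L¹(νM)`, the shift `m`, and the witness `f = g - m` -/

open SpectralContractionRWithoutMeanZero (nu_eq nu_pos integrable_nuM integral_nuM_pos)
open SpectralContractionRWithoutMeasurable (measurable_nuM)

/-- `νM` is continuous. [folklore] -/
theorem continuous_nuM :
    Continuous (fun v : V3 =>
      (∫ w, ∫ ω, hardSphereKernel (v, w) ω * globalMaxwellian w ∂sphereMeasure) * globalMaxwellian v) := by
  have h1 : Continuous (TaggedSphereDiffusion.collisionFrequency (d := Fin 3) 1) :=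
    continuous_collisionFrequency one_pos
  have h2 : Continuous (globalMaxwellian : V3 → ℝ) := by
    unfold Literature.Analysis.FluidPDE.globalMaxwellian; fun_prop
  have : (fun v : V3 =>
      (∫ w, ∫ ω, hardSphereKernel (v, w) ω * globalMaxwellian w ∂sphereMeasure) * globalMaxwellian v) =
      fun v => TaggedSphereDiffusion.collisionFrequency (d := Fin 3) 1 v * globalMaxwellian v := by
    funext v; rw [nu_eq]
  rw [this]
  exact h1.mul h2

/-- `νM > 0` everywhere. [folklore] -/
theorem nuM_pos (v : V3) :
    0 < (∫ w, ∫ ω, hardSphereKernel (v, w) ω * globalMaxwellian w ∂sphereMeasure) * globalMaxwellian v :=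
  mul_pos (nu_pos v) (globalMaxwellian_pos v)

/-- `νM` is bounded on the unit ball. [folklore] -/
theorem exists_nuM_le_on_ball : ∃ C : ℝ, 0 < C ∧ ∀ v ∈ closedBall (0 : V3) 1,
    (∫ w, ∫ ω, hardSphereKernel (v, w) ω * globalMaxwellian w ∂sphereMeasure) * globalMaxwellian v ≤ C := by
  obtain ⟨C, hC⟩ := (isCompact_closedBall (0 : V3) 1).exists_bound_of_continuousOn
    continuous_nuM.continuousOn
  refine ⟨max C 1, by positivity, fun v hv => ?_⟩
  exact ((le_abs_self _).trans ((Real.norm_eq_abs _).symm.le.trans (hC v hv))).trans (le_max_left _ _)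

/-- `νM` is bounded BELOW by a positive constant on the unit ball. [folklore] -/
theorem exists_le_nuM_on_ball : ∃ c₀ : ℝ, 0 < c₀ ∧ ∀ v ∈ closedBall (0 : V3) 1,
    c₀ ≤ (∫ w, ∫ ω, hardSphereKernel (v, w) ω * globalMaxwellian w ∂sphereMeasure) * globalMaxwellian v := by
  obtain ⟨v₀, hv₀, hmin⟩ := (isCompact_closedBall (0 : V3) 1).exists_isMinOn
    ⟨0, mem_closedBall_self zero_le_one⟩ continuous_nuM.continuousOn
  exact ⟨_, nuM_pos v₀, fun v hv => hmin hv⟩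

/-- `g νM` is integrable: `Σ a_n sup_{B₁}(νM) |B(0, r_n)| < ∞`. [folklore] -/
theorem integrable_g_nuM :
    Integrable (fun v : V3 => g v *
      ((∫ w, ∫ ω, hardSphereKernel (v, w) ω * globalMaxwellian w ∂sphereMeasure) * globalMaxwellian v)) := by
  obtain ⟨C, hC, hle⟩ := exists_nuM_le_on_ball
  refine ⟨(measurable_g.mul measurable_nuM).aestronglyMeasurable, ?_⟩
  -- pointwise: ‖g νM‖ₑ ≤ G · (B₁.indicator C)  (g vanishes off the unit ball)
  have hpt : ∀ v : V3, ‖g v * ((∫ w, ∫ ω, hardSphereKernel (v, w) ω * globalMaxwellian w ∂sphereMeasure) *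
      globalMaxwellian v)‖ₑ ≤ G v * ENNReal.ofReal C := by
    intro v
    rw [enorm_mul, Real.enorm_of_nonneg (g_nonneg v), Real.enorm_of_nonneg (nuM_pos v).le]
    by_cases hv : v ∈ closedBall (0 : V3) 1
    · exact mul_le_mul' ENNReal.ofReal_toReal_le (ENNReal.ofReal_le_ofReal (hle v hv))
    · have hG0 : G v = 0 := by
        unfold G
        refine ENNReal.tsum_eq_zero.2 fun n => Set.indicator_of_notMem (fun hn => hv ?_) _
        rw [mem_ball_zero_iff] at hn
        rw [mem_closedBall_zero_iff]
        exact (hn.trans_le (rad_le_one n)).le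
      have hg0 : g v = 0 := by unfold g; rw [hG0, ENNReal.toReal_zero]
      simp [hg0]
  refine lt_of_le_of_lt (lintegral_mono hpt) ?_
  rw [lintegral_G_mul measurable_const volume]
  simp_rw [setLIntegral_const]
  have hterm : ∀ n, ENNReal.ofReal (ampR n) * (ENNReal.ofReal C * volume (ball (0 : V3) (rad n))) =
      ENNReal.ofReal C * volume (ball (0 : V3) 1) * ENNReal.ofReal ((2⁻¹ : ℝ) ^ (5 * (n + 1))) := by
    intro n
    rw [Measure.addHaar_ball volume _ (rad_pos n).le, finrank_euclideanSpace_fin, ← ampR_mul_rad_cube,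
      ENNReal.ofReal_mul (ampR_pos n).le]
    ring
  simp_rw [hterm]
  rw [ENNReal.tsum_mul_left]
  refine ENNReal.mul_lt_top (ENNReal.mul_lt_top ENNReal.ofReal_lt_top measure_ball_lt_top) ?_
  refine lt_of_le_of_lt (ENNReal.tsum_le_tsum fun n => ?_) (tsum_ofReal_half_pow_succ.trans_lt ENNReal.one_lt_top)
  exact ENNReal.ofReal_le_ofReal (pow_le_pow_of_le_one (by norm_num) (by norm_num) (by omega))

/-- The π-mean of `g`: `m = ∫ g νM / ∫ νM`. -/
def mShift : ℝ :=
  (∫ v : V3, g v * ((∫ w, ∫ ω, hardSphereKernel (v, w) ω * globalMaxwellian w ∂sphereMeasure) *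
      globalMaxwellian v)) /
    ∫ v : V3, (∫ w, ∫ ω, hardSphereKernel (v, w) ω * globalMaxwellian w ∂sphereMeasure) * globalMaxwellian v

/-- THE WITNESS `f = g - m`: measurable, π-centred, in `L¹(π) \ L²(π)`. -/
def f (x : V3) : ℝ := g x - mShift

/-- The witness is measurable. [folklore] -/
theorem measurable_f : Measurable f := measurable_g.sub measurable_const

/-- `∫ g νM > 0`. [folklore] -/
theorem integral_g_nuM_pos :
    0 < ∫ v : V3, g v * ((∫ w, ∫ ω, hardSphereKernel (v, w) ω * globalMaxwellian w ∂sphereMeasure) *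
      globalMaxwellian v) := by
  have hnn : 0 ≤ fun v : V3 => g v * ((∫ w, ∫ ω, hardSphereKernel (v, w) ω * globalMaxwellian w ∂sphereMeasure) *
      globalMaxwellian v) := fun v => mul_nonneg (g_nonneg v) (nuM_pos v).le
  rw [integral_pos_iff_support_of_nonneg hnn integrable_g_nuM]
  have hsub : ball (0 : V3) (rad 0) \ {0} ⊆ Function.support (fun v : V3 => g v *
      ((∫ w, ∫ ω, hardSphereKernel (v, w) ω * globalMaxwellian w ∂sphereMeasure) * globalMaxwellian v)) := by
    intro v hv
    rw [Function.mem_support]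
    have hv0 : v ≠ 0 := hv.2
    have hg : 0 < g v := (ampR_pos 0).trans_le (ampR_le_g hv0 hv.1)
    exact (mul_pos hg (nuM_pos v)).ne'
  refine lt_of_lt_of_le ?_ (measure_mono hsub)
  rw [measure_sdiff_null (measure_singleton 0)]
  exact measure_ball_pos _ _ (rad_pos 0)

/-- The shift is positive (`g ≥ 0`, `g > 0` on a ball). [folklore] -/
theorem mShift_pos : 0 < mShift := div_pos integral_g_nuM_pos integral_nuM_pos

/-- `f` is π-centred (an honest mean: `g νM ∈ L¹`). [folklore] -/
theorem integral_f_nuM :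
    ∫ v : V3, f v * ((∫ w, ∫ ω, hardSphereKernel (v, w) ω * globalMaxwellian w ∂sphereMeasure) *
      globalMaxwellian v) = 0 := by
  have h : ∀ v : V3, f v * ((∫ w, ∫ ω, hardSphereKernel (v, w) ω * globalMaxwellian w ∂sphereMeasure) *
      globalMaxwellian v) = g v * ((∫ w, ∫ ω, hardSphereKernel (v, w) ω * globalMaxwellian w ∂sphereMeasure) *
      globalMaxwellian v) - mShift * ((∫ w, ∫ ω, hardSphereKernel (v, w) ω * globalMaxwellian w ∂sphereMeasure) *
      globalMaxwellian v) := fun v => by unfold f; ring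
  simp_rw [h]
  rw [integral_sub integrable_g_nuM (integrable_nuM.const_mul _), integral_const_mul, mShift,
    div_mul_cancel₀ _ integral_nuM_pos.ne', sub_self]


/-! ### The typed `K f` is the honest Carleman average: `K f = ν⁻¹ ∫ k g − m` -/

/-- The Carleman spike bound `C₀ = 4 (2π)^{-1/2} |B₁|` is finite. [folklore] -/
theorem C₀_lt_top : ENNReal.ofReal ((Real.sqrt (2 * Real.pi))⁻¹) * (4 * volume (ball (0 : V3) 1)) < ∞ :=
  ENNReal.mul_lt_top ENNReal.ofReal_lt_top (ENNReal.mul_lt_top (by simp) measure_ball_lt_top)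

/-- `u ↦ k₁(v,u) g(v+u)` is integrable for EVERY `v` (spike bound). [folklore] -/
theorem integrable_carleman_g (v : V3) : Integrable fun u => carlemanKernel 1 v u * g (v + u) := by
  refine ⟨((measurable_carlemanKernel_right 1 v).mul
    (measurable_g.comp (measurable_const.add measurable_id))).aestronglyMeasurable, ?_⟩
  show ∫⁻ u, ‖carlemanKernel 1 v u * g (v + u)‖ₑ < ∞
  calc ∫⁻ u, ‖carlemanKernel 1 v u * g (v + u)‖ₑ
      ≤ ∫⁻ u, ENNReal.ofReal (carlemanKernel 1 v u) * G (v + u) := by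
        refine lintegral_mono fun u => ?_
        rw [enorm_mul, Real.enorm_of_nonneg (carlemanKernel_nonneg 1 v u), Real.enorm_of_nonneg (g_nonneg _)]
        exact mul_le_mul_right ENNReal.ofReal_toReal_le _
    _ ≤ _ := lintegral_carlemanKernel_mul_G_le v
    _ < ∞ := C₀_lt_top

/-- `u ↦ k₁(v,u)` is integrable, with integral `ν(v)`. [folklore] -/
theorem integrable_carlemanKernel (v : V3) : Integrable fun u => carlemanKernel 1 v u := by
  refine ⟨(measurable_carlemanKernel_right 1 v).aestronglyMeasurable, ?_⟩
  show ∫⁻ u, ‖carlemanKernel 1 v u‖ₑ < ∞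
  simp_rw [Real.enorm_of_nonneg (carlemanKernel_nonneg 1 v _)]
  rw [lintegral_carlemanKernel (by simp) one_pos v]
  exact ENNReal.ofReal_lt_top

/-- `∫ k₁(v,u) du = ν(v)` (Bochner form of `lintegral_carlemanKernel`). [folklore] -/
theorem integral_carlemanKernel (v : V3) :
    ∫ u, carlemanKernel 1 v u = ∫ w, ∫ ω, hardSphereKernel (v, w) ω * globalMaxwellian w ∂sphereMeasure := by
  rw [integral_eq_lintegral_of_nonneg_ae (Eventually.of_forall (carlemanKernel_nonneg 1 v))
    (measurable_carlemanKernel_right 1 v).aestronglyMeasurable, lintegral_carlemanKernel (by simp) one_pos v,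
    ENNReal.toReal_ofReal, nu_eq]
  rw [← nu_eq]; exact (nu_pos v).le

/-- `u ↦ k₁(v,u) f(v+u)` is integrable for every `v`. [folklore] -/
theorem integrable_carleman_f (v : V3) : Integrable fun u => carlemanKernel 1 v u * f (v + u) := by
  refine ((integrable_carleman_g v).sub ((integrable_carlemanKernel v).mul_const mShift)).congr
    (Eventually.of_forall fun u => ?_)
  simp only [Pi.sub_apply, f]
  ring

/-- The Carleman gain of `f = g - m` splits: `∫ k₁ f(v+·) = ∫ k₁ g(v+·) - m ν(v)`. [folklore] -/
theorem carlemanGain_f (v : V3) :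
    carlemanGain 1 f v = (∫ u, carlemanKernel 1 v u * g (v + u)) -
      mShift * ∫ w, ∫ ω, hardSphereKernel (v, w) ω * globalMaxwellian w ∂sphereMeasure := by
  unfold carlemanGain
  have : ∀ u, carlemanKernel 1 v u * f (v + u) =
      carlemanKernel 1 v u * g (v + u) - carlemanKernel 1 v u * mShift := fun u => by simp only [f]; ring
  simp_rw [this]
  rw [integral_sub (integrable_carleman_g v) ((integrable_carlemanKernel v).mul_const _), integral_mul_const,
    integral_carlemanKernel]
  ring

/-- **The typed `K f v` is honest**, for EVERY `v`: `K f v = ν(v)⁻¹ ∫ k₁(v,u) g(v+u) du - m`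
(Carleman representation `linearBoltzmannGain_eq_carlemanGain`, absolute convergence from the spike bound).
[folklore] -/
theorem K_f_eq (v : V3) :
    (∫ w, ∫ ω, hardSphereKernel (v, w) ω * globalMaxwellian w ∂sphereMeasure)⁻¹ *
        ∫ w, ∫ ω, hardSphereKernel (v, w) ω * globalMaxwellian w * f (collide ω (v, w)).1 ∂sphereMeasure =
      (∫ w, ∫ ω, hardSphereKernel (v, w) ω * globalMaxwellian w ∂sphereMeasure)⁻¹ *
        (∫ u, carlemanKernel 1 v u * g (v + u)) - mShift := by
  have hgain : ∫ w, ∫ ω, hardSphereKernel (v, w) ω * globalMaxwellian w * f (collide ω (v, w)).1 ∂sphereMeasure =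
      linearBoltzmannGain 1 f v := by
    simp only [linearBoltzmannGain_eq, gainIntegrand, maxwellianBeta_one]
  rw [hgain, linearBoltzmannGain_eq_carlemanGain (by simp) one_pos measurable_f v (integrable_carleman_f v),
    carlemanGain_f, mul_sub, ← mul_assoc, mul_comm _ mShift, mul_assoc, inv_mul_cancel₀ (nu_pos v).ne', mul_one]

/-! ### Bounds on the honest `K f` -/

/-- `v ↦ ∫ k₁(v,u) g(v+u) du` is measurable (parametric Bochner integral). [folklore] -/
theorem measurable_Cg : Measurable fun v : V3 => ∫ u, carlemanKernel 1 v u * g (v + u) := by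
  have h : Measurable fun p : V3 × V3 => carlemanKernel 1 p.1 p.2 * g (p.1 + p.2) :=
    (measurable_carlemanKernel 1).mul (measurable_g.comp (measurable_fst.add measurable_snd))
  exact (h.stronglyMeasurable.integral_prod_right' (ν := volume)).measurable

/-- `∫ k₁ g(v+·) ≥ 0`. [folklore] -/
theorem Cg_nonneg (v : V3) : 0 ≤ ∫ u, carlemanKernel 1 v u * g (v + u) :=
  integral_nonneg fun _ => mul_nonneg (carlemanKernel_nonneg _ _ _) (g_nonneg _)

/-- `∫ k₁ g(v+·) ≤ C₀` uniformly in `v`. [folklore] -/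
theorem Cg_le (v : V3) : ∫ u, carlemanKernel 1 v u * g (v + u) ≤
    (ENNReal.ofReal ((Real.sqrt (2 * Real.pi))⁻¹) * (4 * volume (ball (0 : V3) 1))).toReal := by
  rw [integral_eq_lintegral_of_nonneg_ae (Eventually.of_forall fun u =>
      mul_nonneg (carlemanKernel_nonneg _ _ _) (g_nonneg _)) (integrable_carleman_g v).1]
  refine ENNReal.toReal_mono C₀_lt_top.ne ?_
  calc ∫⁻ u, ENNReal.ofReal (carlemanKernel 1 v u * g (v + u))
      ≤ ∫⁻ u, ENNReal.ofReal (carlemanKernel 1 v u) * G (v + u) := by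
        refine lintegral_mono fun u => ?_
        rw [ENNReal.ofReal_mul (carlemanKernel_nonneg _ _ _)]
        exact mul_le_mul_right ENNReal.ofReal_toReal_le _
    _ ≤ _ := lintegral_carlemanKernel_mul_G_le v

/-- The honest `K f` is measurable, BOUNDED, and `≤ -m/2` far out (because `ν(v) ≥ c|v|` while
`∫ k g ≤ C₀`). [folklore] -/
theorem Kf_estimates : ∃ B R₀ : ℝ, 0 < R₀ ∧
    (∀ v : V3, |(∫ w, ∫ ω, hardSphereKernel (v, w) ω * globalMaxwellian w ∂sphereMeasure)⁻¹ *
        (∫ u, carlemanKernel 1 v u * g (v + u)) - mShift| ≤ B) ∧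
    (∀ v : V3, R₀ ≤ ‖v‖ → (∫ w, ∫ ω, hardSphereKernel (v, w) ω * globalMaxwellian w ∂sphereMeasure)⁻¹ *
        (∫ u, carlemanKernel 1 v u * g (v + u)) - mShift ≤ -(mShift / 2)) := by
  obtain ⟨a₀, ha₀, c, hc, hlow⟩ :=
    exists_collisionFrequency_lowerBound (d := Fin 3) (by simp) one_pos
  set C : ℝ := (ENNReal.ofReal ((Real.sqrt (2 * Real.pi))⁻¹) * (4 * volume (ball (0 : V3) 1))).toReal with hC
  have hC0 : 0 ≤ C := ENNReal.toReal_nonneg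
  have hm := mShift_pos
  refine ⟨C / a₀ + mShift, max 1 (2 * C / (c * mShift)), lt_max_of_lt_left one_pos, fun v => ?_, fun v hv => ?_⟩
  · have hν : a₀ ≤ ∫ w, ∫ ω, hardSphereKernel (v, w) ω * globalMaxwellian w ∂sphereMeasure := by
      rw [nu_eq]; exact (hlow v).1
    have h1 : 0 ≤ (∫ w, ∫ ω, hardSphereKernel (v, w) ω * globalMaxwellian w ∂sphereMeasure)⁻¹ *
        ∫ u, carlemanKernel 1 v u * g (v + u) := mul_nonneg (inv_nonneg.2 (nu_pos v).le) (Cg_nonneg v)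
    have h2 : (∫ w, ∫ ω, hardSphereKernel (v, w) ω * globalMaxwellian w ∂sphereMeasure)⁻¹ *
        (∫ u, carlemanKernel 1 v u * g (v + u)) ≤ C / a₀ := by
      rw [div_eq_inv_mul]
      exact mul_le_mul (inv_anti₀ ha₀ hν) (Cg_le v) (Cg_nonneg v) (inv_nonneg.2 ha₀.le)
    rw [abs_le]
    constructor <;> linarith
  · have hR : 2 * C / (c * mShift) ≤ ‖v‖ := (le_max_right _ _).trans hv
    have hν : c * ‖v‖ ≤ ∫ w, ∫ ω, hardSphereKernel (v, w) ω * globalMaxwellian w ∂sphereMeasure := by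
      rw [nu_eq]; exact (hlow v).2
    have hνpos := nu_pos v
    -- C ≤ (m/2) ν(v)
    have h3 : C ≤ mShift / 2 * ∫ w, ∫ ω, hardSphereKernel (v, w) ω * globalMaxwellian w ∂sphereMeasure := by
      have : 2 * C ≤ c * mShift * ‖v‖ := by
        rw [div_le_iff₀ (mul_pos hc hm)] at hR; linarith
      nlinarith
    have h4 : (∫ w, ∫ ω, hardSphereKernel (v, w) ω * globalMaxwellian w ∂sphereMeasure)⁻¹ *
        (∫ u, carlemanKernel 1 v u * g (v + u)) ≤ mShift / 2 := by
      rw [inv_mul_le_iff₀ hνpos]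
      exact (Cg_le v).trans (by linarith)
    linarith


end SpectralContractionRWithoutIntegrable

end Summit.AtomisticToContinuum.HydrodynamicLimit.Theorems

end
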